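import Literature.AlgebraicGeometry.Resolution.Kuhlmann2019HenselianRationalityFiniteRank
import Literature.AlgebraicGeometry.Resolution.Kuhlmann2019HenselianRationalityProofs
import Literature.AlgebraicGeometry.Resolution.HenselizationSeparablyDefectless
import Literature.AlgebraicGeometry.Resolution.HenselizationCoarsening
import Literature.AlgebraicGeometry.Resolution.CompositeResidueExtensions
import HarnessLib

/-!
# Kuhlmann 2019, Prop. 5.6 (finite rank) from Prop. 5.2 (rank one): the proof

Topic: `Literature/AlgebraicGeometry/Resolution` (valued function fields). PROVED assembly of the
named fact `Kuhlmann2019_Prop56_sepClosed` (`Kuhlmann2019HenselianRationalitySteps.lean` =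
F.-V. Kuhlmann, *Elimination of ramification II: Henselian rationality*, Israel J. Math. 234
(2019) = arXiv:1701.05508, **Prop. 5.6** for a separably closed ground field `K` of finite
rank) from the two theory-sized ingredients of its printed proof vendored in
`Kuhlmann2019HenselianRationalityFiniteRank.lean` —

* `Kuhlmann2019_Prop52_sepClosed` — Prop. 5.2: the theorem over separable-algebraically closed
  base fields of rank one;
* `Kuhlmann2010SeparablyDefectlessRationalRT_sepClosed` — [16, Thm. 1]: `(K(x), P₁)` is
  separably defectless when `xP₁` is transcendental over `KP₁`;

— and the fact `Kuhlmann2019_Lemma54` (Lemma 5.4, Steps file), together with the discharged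
facts `Kuhlmann2010SeparablyDefectlessIffHenselization_holds` ([4, (18.2)]),
`Kuhlmann2010HenselizationIsHenselian_holds`, `Kuhlmann2010HenselizationImmediate_holds`
(Lemma 2.1), `KuhlmannNovacoski2014_Thm12_holds` ([19, Thm. 1.2]: henselian elements),
`Kuhlmann2010HenselsLemma_holds` and `KnafKuhlmann2009_Lemma21_holds` ([15, Lemma 2.16]).

## The printed proof (p. 13 of the arXiv version) and this rendering

> *Proof.* Since `F` has finite rank and `F|K` is an immediate extension of transcendence
> degree 1, there exist places `P = P₁P₂P₃` where `P₁` and `P₃` may be trivial and `P₂` has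
> rank 1, such that … By [17, Lemma 3.14] … Since `(F|K,P)` is immediate, it follows from
> Lemma 5.5 that `v_{P₁}F = v_{P₁}K`, `v_{P₂}(FP₁) = v_{P₂}(KP₁)`, and that the algebraic
> extension `(FP₁P₂|KP₁P₂, P₃)` is immediate. Since the tame field `(KP₁P₂,P₃)` is defectless,
> the latter extension must be trivial. This yields that also `(FP₁|KP₁, P₂)` is immediate. By
> Proposition 5.3 … `(FP₁)^{h(P₂)} = KP₁(xP₁)^{h(P₂)}` for a suitable `x ∈ F` which is
> consequently transcendental over `K` with `xP₁` transcendental over `KP₁`. Applying Lemma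
> 5.4 with `Q = P₁` we see that `x` can be chosen to be a separating element for `F|K`, so that
> `F|K(x)` is a finite separable extension. Our goal is to show that `F^{h(P)} = K(x)^{h(P)}`.
> [… `F^{h(P)} = F^{h(P₁P₂)}`, `K(x)^{h(P)} = K(x)^{h(P₁P₂)}` by Lemma 5.5 (b);
> `F^{h(P)}P₁ = (FP₁)^{h(P₂)} = K(x)^{h(P)}P₁` by Lemma 5.5 (c) and (5.2); hence
> `(F^{h(P)}|K(x)^{h(P)}, P₁)` is immediate …] We have already noted that `(K,P₁)` is a
> separably tame and hence separably defectless field. Since `xP₁` is transcendental over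
> `KP₁`, we can apply [16, Theorem 1] to find that `(K(x),P₁)` is a separably defectless
> field. By [4, Theorem (18.2)], also `(K(x)^{h(P₁)},P₁)` is a separably defectless field.
> [… Lemma 5.5 (c), [17, Prop. 2.12]: so is `(K(x)^{h(P)}, P₁)` …] Since the extension
> `F|K(x)` is finite and separable, Lemma 2.1 shows that the same is true for the extension
> `(F^{h(P)}|K(x)^{h(P)},P₁)`. As this extension is also immediate and `(K(x)^{h(P)},P₁)` is a
> henselian separably defectless field, it follows that the extension must be trivial.

For a separably closed `K` every coarsening `(K, P₁)` is separably closed and every proper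
residue field `KP₁` is algebraically closed (Knaf–Kuhlmann 2009, Lemma 2.1), so the
decomposition `P = P₁P₂P₃` may be taken one convex subgroup at a time: we argue by INDUCTION
ON THE RANK of `(K, P)`. If the rank is one, Prop. 5.2 applies directly. Otherwise let `P₁` be
the finest proper coarsening of `P` (`W ∩ K` the minimal proper overring of `V ∩ K`,
`exists_minimal_proper_overring`). If `FP₁ | KP₁` is algebraic, it is trivial (`KP₁` is
algebraically closed), so `(F|K, P₁)` is immediate of smaller rank and the induction
hypothesis gives `F ⊆ K(x)^{h(P₁)} ⊆ K(x)^{h(P)}` (`henselization_antitone`). If `FP₁ | KP₁`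
is transcendental, then `(FP₁|KP₁, P̄)` — `P̄` the place induced by `P` on `ΩP₁`, of rank one
on `KP₁` (`isRankOne_resField_of_minimal`) — is an immediate (`IsImmediateOver.resField_of_le`)
separable function field of transcendence degree `1` over an algebraically closed field, and
Prop. 5.2 gives `FP₁ ⊆ KP₁(x₁)^{h(P̄)}`; Lemma 5.4 with `Q = P₁` gives a separating `x ∈ F`
with `xP₁ = x₁`. The final step `F ⊆ K(x)^{h(P)}` (`le_henselization_of_resField_le`)
replaces Lemma 5.5 (b), (c) and [17, Prop. 2.12] by an explicit Hensel-root argument using the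
same ingredients [16, Thm. 1], [4, (18.2)], Lemma 2.1: with `N = K(x)^{h(P₁)}` (henselian and
separably defectless for `P₁`) and `M = F.N` (finite, separable, with `v_{P₁}M = v_{P₁}N` and
`MP₁ = FP₁`), the finite subextension `FP₁ | KP₁(x₁)` of the henselization is generated by a
henselian element `η̄` with minimal polynomial `h̄` ([19, Thm. 1.2]); a monic lift `h` of `h̄`
over `O_{K(x)}` has a root `α'' ∈ M` with `α''P₁ = η̄` (Hensel's Lemma for `P₁` in `M`) and a
root `α ∈ K(x)^{h(P)}` congruent to a lift of `η̄` modulo `𝔪_P` (Hensel's Lemma for `P`, the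
approximate root taken in `K` by immediacy); by the uniqueness of Hensel roots for `P`,
`α = α''`; and `[N(α) : N] ≥ [N(α)P₁ : NP₁] = [MP₁ : NP₁] = [M : N]` (fundamental inequality;
`[M : N] = e·f = f` by separable defectlessness), so `F ⊆ M = N(α) ⊆ K(x)^{h(P)}`
(`N ⊆ K(x)^{h(P)}` by `henselization_antitone`).

## Content (PROVED)

* `le_henselization_of_resField_le` — the final step just described.
* `Kuhlmann2019_Prop56_sepClosed.of_prop52 : Kuhlmann2019_Prop52_sepClosed →
  Kuhlmann2010SeparablyDefectlessRationalRT_sepClosed → Kuhlmann2019_Lemma54 →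
  Kuhlmann2019_Prop56_sepClosed` — **Prop. 5.6 for separably closed `K` from Prop. 5.2,
  [16, Thm. 1] and Lemma 5.4.**
* `Kuhlmann2019_Thm13_sepClosed.of_prop52` — hence Thm. 1.3 (separably closed `K`, arbitrary
  rank) from Prop. 5.2, the two clauses of [16, Thm. 1], Lemma 5.4 and [17, Cor. 3.8/3.16]
  (through `Kuhlmann2019_Thm13_sepClosed.of_prop56` and
  `Kuhlmann2010SeparablyDefectlessIffHenselization_holds`).

## Sources

* F.-V. Kuhlmann, Israel J. Math. 234 (2019) = arXiv:1701.05508: Lemma 2.1, §5.3 (Lemma 5.4,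
  Lemma 5.5, Prop. 5.6, p. 13), Prop. 5.2 (p. 12); its references [4] Endler, [15] Kuhlmann
  2004, [16] Kuhlmann 2010, [17] Kuhlmann 2016, [19] Kuhlmann–Novacoski 2014.
* H. Knaf, F.-V. Kuhlmann, Adv. Math. 221 (2009): Lemma 2.1.
-/

noncomputable section

open IsLocalRing Polynomial

namespace Literature.AlgebraicGeometry.Resolution

universe u

variable {Ω : Type u} [Field Ω]

/-! ### The final step: `F ⊆ K(x)^{h(P)}` from `FP₁ ⊆ KP₁(x₁)^{h(P̄)}` -/

section Lift

variable [IsAlgClosed Ω]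

/-- **The final step of the proof of Prop. 5.6 (separably closed `K`).** Let `V ≤ W` be
valuation rings of the algebraically closed `Ω` (`P` and its coarsening `P₁`), `K ≤ F`
subfields with `K` separably closed, `F|K` finitely generated and `(F|K, V)` immediate, and
`x ∈ F` residue-transcendental for `W` over `K` with `F|K(x)` separable ("`x` can be chosen to
be a separating element for `F|K`, so that `F|K(x)` is a finite separable extension"). If
`FP₁ ⊆ KP₁(xP₁)^{h(P̄)}` inside `ΩP₁` (`P̄` the place induced by `V`), then `F ⊆ K(x)^{h(P)}`.
PROVED along the lines described in the module docstring, from [16, Thm. 1]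
(`Kuhlmann2010SeparablyDefectlessRationalRT_sepClosed`), [4, (18.2)], Lemma 2.1, [19, Thm. 1.2]
and Hensel's Lemma. [cite: Kuhlmann2019, Prop. 5.6 (proof)] -/
theorem le_henselization_of_resField_le {V W : ValuationSubring Ω} (hVW : V ≤ W)
    (hGST : Kuhlmann2010SeparablyDefectlessRationalRT_sepClosed.{u})
    {K F : Subfield Ω} [IsSepClosed K] (hKF : K ≤ F) (hfg : FGOver K F)
    (himm : IsImmediateOver V K F) {x : Ω} (hxF : x ∈ F) (hx : IsResidueTranscendental W K x)
    (hxsep : ∀ z ∈ F, IsSeparable (IntermediateField.adjoin K ({x} : Set Ω)) z)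
    (hF₁ : resField W F ≤ henselization (residueValuationSubring V W hVW)
      (Subfield.closure ((resField W K : Set (ResidueField W)) ∪ {residue W ⟨x, hx.mem⟩}))) :
    F ≤ henselization V (Subfield.closure ((K : Set Ω) ∪ {x})) := by
  classical
  haveI : IsAlgClosed (ResidueField W) := isAlgClosed_residueField_of_isAlgClosed W
  set V₁ : ValuationSubring (ResidueField W) := residueValuationSubring V W hVW with hV₁
  set K₁ : Subfield (ResidueField W) := resField W K with hK₁
  set F₁ : Subfield (ResidueField W) := resField W F with hF₁def
  set x₁ : ResidueField W := residue W ⟨x, hx.mem⟩ with hx₁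
  set L : Subfield (ResidueField W) :=
    Subfield.closure ((K₁ : Set (ResidueField W)) ∪ {x₁}) with hL
  set G : Subfield Ω := Subfield.closure ((K : Set Ω) ∪ {x}) with hG
  set N : Subfield Ω := henselization W G with hN
  set H : Subfield Ω := henselization V G with hH
  set M : Subfield Ω := F ⊔ N with hM
  have hHh := Kuhlmann2010HenselizationIsHenselian_holds.{u}
  have hIm := Kuhlmann2010HenselizationImmediate_holds.{u}
  -- inclusions
  have hKG : K ≤ G := fun c hc => Subfield.subset_closure (Or.inl hc)
  have hGF : G ≤ F :=
    Subfield.closure_le.mpr (Set.union_subset hKF (Set.singleton_subset_iff.mpr hxF))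
  have hGN : G ≤ N := le_henselization W G
  have hGH : G ≤ H := le_henselization V G
  have hNH : N ≤ H := henselization_antitone G hVW
  have hNM : N ≤ M := le_sup_right
  have hFM : F ≤ M := le_sup_left
  have hMFh : M ≤ henselization W F :=
    sup_le (le_henselization W F) (henselization_mono W hHh hGF)
  have hK₁F₁ : K₁ ≤ F₁ := resField_mono W hKF
  have hx₁F₁ : x₁ ∈ F₁ := residue_mem_resField W ⟨x, hx.mem⟩ hxF
  have hLF₁ : L ≤ F₁ :=
    Subfield.closure_le.mpr (Set.union_subset hK₁F₁ (Set.singleton_subset_iff.mpr hx₁F₁))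
  -- Gauss: `GW = K₁(x₁) = L` (Kuhlmann 2010, Lemma 2.5)
  have hGres : resField W G = L := by
    have h := residueSubfield_adjoin_eq_of_isResidueTranscendental W hx
    rw [adjoin_toSubfield_eq_closure, residueSubfield_subfield_eq_resField,
      residueSubfield_subfield_eq_resField] at h
    exact h
  -- `F | G` is finite separable
  obtain ⟨s, hs⟩ := hfg.of_le hKG hGF
  have hsF : (↑s : Set Ω) ⊆ F := fun z hz => hs ▸ Subfield.subset_closure (Or.inr hz)
  have hsepG : ∀ z ∈ F, IsSeparable G z := fun z hz =>
    (isSeparable_closure_iff K {x} z).mpr (hxsep z hz)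
  have hposGF : 0 < Subfield.relfinrank G F := by
    rw [← hs]
    exact relfinrank_closure_pos G s fun a ha => (hsepG a (hsF ha)).isIntegral
  -- `[F₁ : L] ≤ [F : G] < ∞`
  have hposLF₁ : 0 < Subfield.relfinrank L F₁ := by
    obtain ⟨-, hf, -⟩ := relIndex_mul_relfinrank_le_relfinrank W hGF hposGF
    rw [residueSubfield_subfield_eq_resField, residueSubfield_subfield_eq_resField, hGres] at hf
    exact hf
  have hfin₁ : FiniteOver L F₁ := finiteOver_of_relfinrank_pos hLF₁ hposLF₁
  -- the henselian element of `F₁ | L` (Kuhlmann–Novacoski 2014, Thm. 1.2)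
  obtain ⟨η, hηF₁, hηV₁, hgen, hb, hbmon, hbcoef, hbev, hbder⟩ :=
    KuhlmannNovacoski2014_Thm12_holds.exists_henselRoot (ResidueField W) V₁ L F₁ hLF₁ hfin₁ hF₁
  -- lift `hb` to a monic `q` over `O_G = V ∩ G`
  set OG : ValuationSubring G := V.comap (algebraMap G Ω) with hOG
  let j : OG →+* W := (V.inclusion W hVW).comp (comapSubringHom G V)
  let ρ : OG →+* ResidueField W := (residue W).comp j
  have hlifts : hb ∈ Polynomial.lifts ρ := by
    rw [Polynomial.lifts_iff_coeff_lifts]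
    intro k
    obtain ⟨hkV₁, hkL⟩ := hbcoef k
    rw [← hGres] at hkL
    obtain ⟨c, hcG, hc⟩ := (mem_resField_iff W G _).mp hkL
    rw [← hc] at hkV₁
    have hcV : (c : Ω) ∈ V := (residue_mem_residueValuationSubring_iff V W hVW c).mp hkV₁
    refine ⟨⟨⟨c, hcG⟩, hcV⟩, ?_⟩
    rw [← hc]
    exact congrArg (residue W) (Subtype.ext rfl)
  obtain ⟨q, hq, -, hqmon⟩ := Polynomial.lifts_and_degree_eq_and_monic hlifts hbmon
  -- the lift `h` over `Ω`, through `qW` over `W` (kept opaque, with defining equations)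
  obtain ⟨qW, hqW⟩ : ∃ qW : Polynomial W, qW = q.map j := ⟨_, rfl⟩
  obtain ⟨h, hh⟩ : ∃ h : Polynomial Ω, h = qW.map W.subtype := ⟨_, rfl⟩
  have hhb : qW.map (residue W) = hb := by
    rw [hqW, Polynomial.map_map]
    exact hq
  have hmon : h.Monic := by
    rw [hh, hqW]
    exact (hqmon.map j).map _
  have hcoef : ∀ k, h.coeff k ∈ V ∧ h.coeff k ∈ G := fun k => by
    rw [hh, hqW, Polynomial.coeff_map, Polynomial.coeff_map]
    exact ⟨(q.coeff k).2, ((q.coeff k : OG) : G).2⟩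
  have hcoefV : ∀ k, h.coeff k ∈ V := fun k => (hcoef k).1
  have hderh : derivative h = ((derivative q).map j).map W.subtype := by
    rw [hh, hqW, Polynomial.derivative_map, Polynomial.derivative_map]
  have hcoefdV : ∀ k, (derivative h).coeff k ∈ V := fun k => by
    rw [hderh, Polynomial.coeff_map, Polynomial.coeff_map]
    exact ((derivative q).coeff k).2
  have heval : ∀ a : W, h.eval (a : Ω) = ((qW.eval a : W) : Ω) := fun a => by
    rw [hh, Polynomial.eval_map]
    exact Polynomial.eval₂_hom W.subtype a
  have hevalres : ∀ a : W, residue W (qW.eval a) = hb.eval (residue W a) := fun a => by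
    rw [← hhb, Polynomial.eval_map]
    exact (Polynomial.eval₂_hom (residue W) a).symm
  have hevald : ∀ a : W, (derivative h).eval (a : Ω) = (((derivative qW).eval a : W) : Ω) :=
    fun a => by
    rw [hh, Polynomial.derivative_map, Polynomial.eval_map]
    exact Polynomial.eval₂_hom W.subtype a
  have hevaldres : ∀ a : W,
      residue W ((derivative qW).eval a) = (derivative hb).eval (residue W a) := fun a => by
    rw [← hhb, Polynomial.derivative_map, Polynomial.eval_map]
    exact (Polynomial.eval₂_hom (residue W) a).symm
  -- `a ∈ F ∩ W`, a lift of `η`; `h(a) ∈ 𝔪_W`, `h'(a)` a unit of `V`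
  obtain ⟨a, haF, haη⟩ := (mem_resField_iff W F η).mp hηF₁
  have haV : (a : Ω) ∈ V := by
    rw [← haη] at hηV₁
    exact (residue_mem_residueValuationSubring_iff V W hVW a).mp hηV₁
  have hW1 : W.valuation (h.eval (a : Ω)) < 1 := by
    rw [heval, ← ValuationSubring.valuation_lt_one_iff, ← residue_eq_zero_iff, hevalres, haη]
    exact hbev
  have hbder0 : (derivative hb).eval η ≠ 0 := fun h0 => by
    rw [h0, map_zero] at hbder
    exact zero_ne_one hbder
  have hu : IsUnit ((derivative qW).eval a) := by
    by_contra hnu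
    apply hbder0
    rw [← haη, ← hevaldres]
    exact (residue_eq_zero_iff _).mpr ((IsLocalRing.mem_maximalIdeal _).mpr hnu)
  have hW2 : W.valuation ((derivative h).eval (a : Ω)) = 1 := by
    rw [hevald]
    exact (W.valuation_eq_one_iff _).mp hu
  have hV2 : V.valuation ((derivative h).eval (a : Ω)) = 1 := by
    rw [hevald, ← valuation_residue_eq_one_iff hVW, hevaldres, haη]
    exact hbder
  have hV1 : V.valuation (h.eval (a : Ω)) < 1 := (mem_and_valuation_lt_one_of_le hVW hW1).2
  -- `M = F.N = N(s)` is finite separable over `N`, and henselian for `W`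
  have hsepN : ∀ z ∈ (↑s : Set Ω), IsSeparable N z := fun z hz =>
    isSeparable_of_subfield_le hGN (hsepG z (hsF hz))
  have hMeq : M = Subfield.closure ((N : Set Ω) ∪ ↑s) := by
    refine le_antisymm (sup_le ?_ fun z hz => Subfield.subset_closure (Or.inl hz))
      (Subfield.closure_le.mpr (Set.union_subset (fun z hz => hNM hz) fun z hz => hFM (hsF hz)))
    rw [← hs]
    exact Subfield.closure_le.mpr (Set.union_subset
      (fun z hz => Subfield.subset_closure (Or.inl (hGN hz)))
      fun z hz => Subfield.subset_closure (Or.inr hz))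
  have hsepM : ∀ z ∈ M, IsSeparable N z := fun z hz => by
    rw [hMeq] at hz
    exact isSeparable_of_mem_closure hsepN hz
  have halgM : ∀ z ∈ M, IsAlgebraic N z := fun z hz => (hsepM z hz).isIntegral.isAlgebraic
  have hhensN : IsHenselianField N (W.comap (algebraMap N Ω)) := hHh Ω W G
  have hhensM : IsHenselianField M (W.comap (algebraMap M Ω)) :=
    IsHenselianField.of_subfield_algebraic W hNM halgM hhensN
  -- Hensel's Lemma for `W` in `M`: a root `α''` of `h` with `α''W = η`
  have hcoefWM : ∀ k, h.coeff k ∈ W ∧ h.coeff k ∈ M := fun k =>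
    ⟨hVW (hcoef k).1, (hGN.trans hNM) (hcoef k).2⟩
  obtain ⟨α'', hα''M, hα''W, hα''root, hα''a⟩ :=
    exists_root_of_isHenselianField W hhensM hmon hcoefWM (hFM haF) a.2 hW1 hW2
  -- Hensel's Lemma for `V` in `H = G^{h(V)}`: a root `α` of `h` close to `a` (via `b ∈ K`)
  obtain ⟨b, hbK, hb'⟩ :=
    (mem_resField_iff V K _).mp (himm.2 (residue_mem_resField V ⟨(a : Ω), haV⟩ haF))
  have hab : V.valuation ((a : Ω) - b) < 1 := by
    have := (residue_eq_residue_iff V b ⟨(a : Ω), haV⟩).mp hb'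
    rwa [Valuation.map_sub_swap] at this
  have hba : V.valuation ((b : Ω) - a) < 1 := by
    rw [Valuation.map_sub_swap]
    exact hab
  have hV1b : V.valuation (h.eval (b : Ω)) < 1 := by
    have h1 := valuation_eval_sub_lt_one V hcoefV b.2 haV hba
    have : h.eval (b : Ω) = (h.eval (b : Ω) - h.eval (a : Ω)) + h.eval (a : Ω) := by ring
    rw [this]
    exact V.valuation.map_add_lt h1 hV1
  have hV2b : V.valuation ((derivative h).eval (b : Ω)) = 1 :=
    valuation_eq_one_of_sub V hV2 (valuation_eval_sub_lt_one V hcoefdV b.2 haV hba)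
  have hhensH : IsHenselianField H (V.comap (algebraMap H Ω)) := hHh Ω V G
  have hcoefVH : ∀ k, h.coeff k ∈ V ∧ h.coeff k ∈ H := fun k => ⟨(hcoef k).1, hGH (hcoef k).2⟩
  obtain ⟨α, hαH, hαV, hαroot, hαb⟩ :=
    exists_root_of_isHenselianField V hhensH hmon hcoefVH ((hKG.trans hGH) hbK) b.2 hV1b hV2b
  -- uniqueness of Hensel roots for `V`: `α = α''`
  have hα''a' := mem_and_valuation_lt_one_of_le hVW hα''a
  have hα''V : α'' ∈ V := by
    have : α'' = (α'' - a) + a := by ring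
    rw [this]
    exact V.add_mem _ _ hα''a'.1 haV
  have hαα'' : V.valuation (α'' - α) < 1 := by
    have : α'' - α = (α'' - a) + (((a : Ω) - b) + ((b : Ω) - α)) := by ring
    rw [this]
    refine V.valuation.map_add_lt hα''a'.2 (V.valuation.map_add_lt hab ?_)
    rw [Valuation.map_sub_swap]
    exact hαb
  have hderα : V.valuation ((derivative h).eval α) = 1 :=
    valuation_eq_one_of_sub V hV2b (valuation_eval_sub_lt_one V hcoefdV hαV b.2 hαb)
  have hαeq : α = α'' :=
    eq_of_roots_of_valuation_sub_lt_one V hcoefV hαV hα''V hαroot hα''root hαα'' hderα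
  -- `N(α) ⊆ M ∩ H`
  set Nα : Subfield Ω := Subfield.closure ((N : Set Ω) ∪ {α}) with hNα
  have hNNα : N ≤ Nα := fun z hz => Subfield.subset_closure (Or.inl hz)
  have hαM : α ∈ M := hαeq ▸ hα''M
  have hNαM : Nα ≤ M :=
    Subfield.closure_le.mpr (Set.union_subset hNM (Set.singleton_subset_iff.mpr hαM))
  have hNαH : Nα ≤ H :=
    Subfield.closure_le.mpr (Set.union_subset hNH (Set.singleton_subset_iff.mpr hαH))
  -- `N` is henselian and separably defectless for `W` ([16, Thm. 1] and [4, (18.2)])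
  have hsdN : IsSeparablyDefectlessField N (W.comap (algebraMap N Ω)) :=
    (Kuhlmann2010SeparablyDefectlessIffHenselization_holds Ω W G).mp (hGST.apply W K x hx)
  -- `[M : N] = [MW : NW]`: `e = 1` since `v_W M = v_W F = v_W K ⊆ v_W N` (Lemma 2.1)
  have hposNM : 0 < Subfield.relfinrank N M := by
    rw [hMeq]
    exact relfinrank_closure_pos N s fun z hz => (hsepN z hz).isIntegral
  have hvalM : ∀ z ∈ M, z ≠ 0 → ∃ c ∈ N, W.valuation z = W.valuation c := fun z hz hz0 => by
    obtain ⟨b₀, hb₀F, hzb₀⟩ := (hIm Ω W F).1 z (hMFh hz) hz0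
    have hb₀0 : b₀ ≠ 0 := by
      rintro rfl
      rw [map_zero, map_eq_zero] at hzb₀
      exact hz0 hzb₀
    obtain ⟨c, hcK, hc⟩ := himm.valuation_of_le hVW b₀ hb₀F hb₀0
    exact ⟨c, hGN (hKG hcK), hzb₀.trans hc⟩
  have hdeg := relfinrank_eq_relIndex_mul_relfinrank_of_isSeparablyDefectlessField W hNM hhensN
    hsdN hposNM hsepM
  rw [valueSubgroup_eq_of_forall_valuation_eq W hNM hvalM, Subgroup.relIndex_self, one_mul,
    residueSubfield_subfield_eq_resField, residueSubfield_subfield_eq_resField] at hdeg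
  -- residue fields: `MW = F₁ = N(α)W`
  have hresM : resField W M = F₁ :=
    le_antisymm ((resField_mono W hMFh).trans (hIm Ω W F).2) (resField_mono W hFM)
  have hresα : residue W ⟨α'', hα''W⟩ = η := by
    rw [← haη]
    exact (residue_eq_residue_iff W _ _).mpr hα''a
  have hresNα : resField W Nα = F₁ := by
    refine le_antisymm ((resField_mono W hNαM).trans hresM.le) ?_
    rw [← hgen]
    refine Subfield.closure_le.mpr (Set.union_subset ?_ ?_)
    · rw [← hGres]
      exact fun w hw => resField_mono W (hGN.trans hNNα) hw
    · have hα''Nα : α'' ∈ Nα := by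
        rw [← hαeq]
        exact Subfield.subset_closure (Or.inr rfl)
      rw [Set.singleton_subset_iff, ← hresα]
      exact residue_mem_resField W ⟨α'', hα''W⟩ hα''Nα
  -- `[N(α) : N] ≥ [N(α)W : NW] = [MW : NW] = [M : N]`
  have hposNNα : 0 < Subfield.relfinrank N Nα := by
    rw [hNα, ← Finset.coe_singleton]
    refine relfinrank_closure_pos N {α} fun z hz => ?_
    rw [Finset.mem_singleton] at hz
    rw [hz]
    exact (hsepM α hαM).isIntegral
  obtain ⟨he, -, hef⟩ := relIndex_mul_relfinrank_le_relfinrank W hNNα hposNNα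
  rw [residueSubfield_subfield_eq_resField, residueSubfield_subfield_eq_resField, hresNα] at hef
  rw [hresM] at hdeg
  have hle : Subfield.relfinrank N M ≤ Subfield.relfinrank N Nα := by
    rw [hdeg]
    exact le_trans (Nat.le_mul_of_pos_left _ he) hef
  have htower := Subfield.relfinrank_mul_relfinrank hNNα hNαM
  have hpos' : 0 < Subfield.relfinrank Nα M := by
    rcases Nat.eq_zero_or_pos (Subfield.relfinrank Nα M) with h0 | h0
    · rw [h0, mul_zero] at htower
      rw [← htower] at hposNM
      exact absurd hposNM (lt_irrefl 0)
    · exact h0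
  have h1 : Subfield.relfinrank Nα M = 1 := by
    refine le_antisymm (Nat.le_of_mul_le_mul_left ?_ hposNNα) hpos'
    rw [mul_one, htower]
    exact hle
  have hMNα : M ≤ Nα := Subfield.relfinrank_eq_one_iff.mp h1
  exact hFM.trans (hMNα.trans hNαH)

end Lift

/-! ### Prop. 5.6 (separably closed `K`) from Prop. 5.2 by induction on the rank -/

section Assembly

/-- **Kuhlmann 2019, Prop. 5.6 for a separably closed ground field of finite rank, from
Prop. 5.2 (rank one), [16, Thm. 1] (separably defectless clause, residue-transcendental
generator) and Lemma 5.4** — by induction on the rank of `(K, V ∩ K)` as described in the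
module docstring. [cite: Kuhlmann2019, Prop. 5.6] -/
theorem Kuhlmann2019_Prop56_sepClosed.of_prop52 (h52 : Kuhlmann2019_Prop52_sepClosed.{u})
    (hGST : Kuhlmann2010SeparablyDefectlessRationalRT_sepClosed.{u})
    (h54 : Kuhlmann2019_Lemma54.{u}) : Kuhlmann2019_Prop56_sepClosed.{u} := by
  intro Ω _ _ V K F hK hrank hKF hfg hsep h1 himm
  haveI := hK
  -- induction on the number of overrings of `V ∩ K`, for all `V`
  suffices key : ∀ (n : ℕ) (V : ValuationSubring Ω), HasFiniteRank V K →
      Nat.card {S : ValuationSubring K // V.comap (algebraMap K Ω) ≤ S} = n →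
      IsImmediateOver V K F →
      ∃ x ∈ F, Transcendental K x ∧
        F ≤ henselization V (Subfield.closure ((K : Set Ω) ∪ {x})) from
    key _ V hrank rfl himm
  intro n
  induction n using Nat.strong_induction_on with
  | h n ih =>
  intro V hrank hn himm
  haveI : Finite {S : ValuationSubring K // V.comap (algebraMap K Ω) ≤ S} := hrank
  obtain ⟨t, htF, ht, halg⟩ := h1
  set O : ValuationSubring K := V.comap (algebraMap K Ω) with hO
  -- `v` is non-trivial on `K`
  have htK : t ∉ K := fun h => ht (isAlgebraic_algebraMap (⟨t, h⟩ : K))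
  obtain ⟨c, hcK, hc0, hc1⟩ := exists_valuation_ne_one_of_isImmediateOver V hKF himm htF htK
  have hOtop : O ≠ ⊤ := by
    intro htop
    have hcO : (⟨c, hcK⟩ : K) ∈ O := by
      rw [htop]
      exact ValuationSubring.mem_top _
    have hciO : (⟨c, hcK⟩ : K)⁻¹ ∈ O := by
      rw [htop]
      exact ValuationSubring.mem_top _
    exact hc1 ((valuation_eq_one_iff_mem_and_inv_mem V hc0).mpr
      ⟨ValuationSubring.mem_comap.mp hcO, ValuationSubring.mem_comap.mp hciO⟩)
  by_cases hr1 : ∀ S : ValuationSubring K, O ≤ S → S = O ∨ S = ⊤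
  · -- rank one: Prop. 5.2
    exact h52.prop56_of_isRankOne V K F hK ⟨hOtop, hr1⟩ hKF hfg hsep ⟨t, htF, ht, halg⟩ himm
  · -- the finest proper coarsening `W` (`W ∩ K = R` minimal among the proper overrings)
    push Not at hr1
    obtain ⟨S₀, hOS₀, hS₀⟩ := hr1
    obtain ⟨R, hOR, hRO, hRtop, hmin⟩ :=
      exists_minimal_proper_overring O ⟨S₀, hOS₀, hS₀.1, hS₀.2⟩
    set W : ValuationSubring Ω := comapHull V (algebraMap K Ω) R with hW
    have hVW : V ≤ W := le_comapHull V _ R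
    have hWK : W.comap (algebraMap K Ω) = R := comap_comapHull V _ R hOR
    -- `W` is non-trivial on `K`; `KW` is algebraically closed; `ΩW` is algebraically closed
    obtain ⟨z, hzR⟩ : ∃ z : K, z ∉ R := by
      by_contra hcon
      push Not at hcon
      exact hRtop (eq_top_iff.mpr fun z _ => hcon z)
    have hzW : (z : Ω) ∉ W := fun h => hzR (by
      rw [← hWK]
      exact ValuationSubring.mem_comap.mpr h)
    have hz0 : (z : Ω) ≠ 0 := fun h0 => hzW (h0 ▸ W.zero_mem)
    have hntW : ∃ c ∈ K, c ≠ 0 ∧ W.valuation c ≠ 1 :=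
      ⟨z, z.2, hz0, fun h1 => hzW ((W.valuation_le_one_iff _).mp h1.le)⟩
    haveI hK₁ : IsAlgClosed (resField W K) :=
      (divisible_and_isAlgClosed_resField_of_isSepClosed W K hntW).2
    haveI : IsAlgClosed (ResidueField W) := isAlgClosed_residueField_of_isAlgClosed W
    by_cases hB : IsResiduallyAlgebraicOver W K F
    · -- Case B: `FW = KW`, so `(F|K, W)` is immediate of smaller rank: induction
      have himmW : IsImmediateOver W K F :=
        ⟨himm.valuation_of_le hVW, fun r hr =>
          mem_of_isAlgebraic_of_isAlgClosed_subfield (resField W K) (hB r hr)⟩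
      have hrankW : HasFiniteRank W K := by
        change Finite {S : ValuationSubring K // W.comap (algebraMap K Ω) ≤ S}
        rw [hWK]
        exact finite_overrings_of_le O R hOR
      have hlt : Nat.card {S : ValuationSubring K // W.comap (algebraMap K Ω) ≤ S} < n := by
        rw [hWK, ← hn]
        exact card_overrings_lt_of_ne O R hOR hRO
      obtain ⟨x, hxF, hxT, hle⟩ := ih _ hlt W hrankW rfl himmW
      exact ⟨x, hxF, hxT, hle.trans (henselization_antitone _ hVW)⟩
    · -- Case A: `FW | KW` is transcendental
      obtain ⟨r, hrF, hrT⟩ : ∃ r ∈ resField W F, Transcendental (resField W K) r := by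
        by_contra hcon
        push Not at hcon
        exact hB fun r hr => by
          have := hcon r hr
          unfold Transcendental at this
          push Not at this
          exact this
      -- a residue-transcendental lift `x' ∈ F` of `r`; `F | K(x')` is finite
      obtain ⟨x', hx'F, hx'r⟩ := (mem_resField_iff W F r).mp hrF
      have hx'RT : IsResidueTranscendental W K (x' : Ω) := ⟨x'.2, by
        have : (⟨(x' : Ω), x'.2⟩ : W) = x' := Subtype.ext rfl
        rw [this, hx'r]
        exact hrT⟩
      have hx'T : Transcendental K (x' : Ω) := hx'RT.transcendental
      have halg' := isAlgebraic_adjoin_singleton_of_transcendental hKF htF hx'F hx'T halg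
      set G' : Subfield Ω := Subfield.closure ((K : Set Ω) ∪ {(x' : Ω)}) with hG'
      have hKG' : K ≤ G' := fun c hc => Subfield.subset_closure (Or.inl hc)
      have hG'F : G' ≤ F :=
        Subfield.closure_le.mpr (Set.union_subset hKF (Set.singleton_subset_iff.mpr hx'F))
      obtain ⟨s', hs'⟩ := hfg.of_le hKG' hG'F
      have hs'F : (↑s' : Set Ω) ⊆ F := fun w hw => hs' ▸ Subfield.subset_closure (Or.inr hw)
      have hposG'F : 0 < Subfield.relfinrank G' F := by
        rw [← hs']
        refine relfinrank_closure_pos G' s' fun w hw => ?_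
        exact ((isAlgebraic_closure_iff K {(x' : Ω)} w).mpr (halg' w (hs'F hw))).isIntegral
      -- the residue fields `K₁ = KW ≤ L' = K₁(r) ≤ F₁ = FW` inside `ΩW`
      set V₁ : ValuationSubring (ResidueField W) := residueValuationSubring V W hVW with hV₁
      set K₁ : Subfield (ResidueField W) := resField W K with hK₁def
      set F₁ : Subfield (ResidueField W) := resField W F with hF₁
      set L' : Subfield (ResidueField W) :=
        Subfield.closure ((K₁ : Set (ResidueField W)) ∪ {r}) with hL'
      have hK₁F₁ : K₁ ≤ F₁ := resField_mono W hKF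
      have hL'F₁ : L' ≤ F₁ :=
        Subfield.closure_le.mpr (Set.union_subset hK₁F₁ (Set.singleton_subset_iff.mpr hrF))
      have hG'res : resField W G' = L' := by
        have h := residueSubfield_adjoin_eq_of_isResidueTranscendental W hx'RT
        rw [adjoin_toSubfield_eq_closure, residueSubfield_subfield_eq_resField,
          residueSubfield_subfield_eq_resField] at h
        have hx'' : residue W ⟨(x' : Ω), hx'RT.mem⟩ = r := by
          rw [← hx'r]
        rw [hx''] at h
        exact h
      have hposL'F₁ : 0 < Subfield.relfinrank L' F₁ := by
        obtain ⟨-, hf, -⟩ := relIndex_mul_relfinrank_le_relfinrank W hG'F hposG'F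
        rw [residueSubfield_subfield_eq_resField, residueSubfield_subfield_eq_resField,
          hG'res] at hf
        exact hf
      have hfin₁ : FiniteOver L' F₁ := finiteOver_of_relfinrank_pos hL'F₁ hposL'F₁
      -- `(F₁ | K₁, V₁)` satisfies the hypotheses of Prop. 5.2
      have hfg₁ : FGOver K₁ F₁ := (fgOver_closure K₁ {r}).trans (by
        rw [Finset.coe_singleton]
        exact hfin₁.fgOver)
      have hsep₁ : SeparablyGeneratedOver K₁ F₁ := separablyGeneratedOver_of_perfectField hfg₁
      have h1₁ : ∃ y ∈ F₁, Transcendental K₁ y ∧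
          ∀ w ∈ F₁, IsAlgebraic (IntermediateField.adjoin K₁ ({y} : Set (ResidueField W))) w :=
        ⟨r, hrF, hrT, fun w hw => (isAlgebraic_closure_iff K₁ {r} w).mp (hfin₁.isAlgebraic hw)⟩
      have himm₁ : IsImmediateOver V₁ K₁ F₁ := himm.resField_of_le hVW
      have hne : V.comap (algebraMap K Ω) ≠ W.comap (algebraMap K Ω) := by
        rw [hWK]
        exact fun h => hRO h.symm
      have hmin' : ∀ S : ValuationSubring K, V.comap (algebraMap K Ω) ≤ S →
          S ≤ W.comap (algebraMap K Ω) →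
          S = V.comap (algebraMap K Ω) ∨ S = W.comap (algebraMap K Ω) := by
        rw [hWK]
        exact hmin
      have hr1₁ : IsRankOne V₁ K₁ := isRankOne_resField_of_minimal hVW hne hmin'
      -- Prop. 5.2 in `ΩW`
      obtain ⟨x₁, hx₁F₁, hx₁T, hF₁le⟩ :=
        h52 (ResidueField W) V₁ K₁ F₁ inferInstance hr1₁ hK₁F₁ hfg₁ hsep₁ h1₁ himm₁
      -- Lemma 5.4 with `Q = W`: a separating `y ∈ F` with `yW = x₁`
      obtain ⟨x₀, hx₀F, hx₀x₁⟩ := (mem_resField_iff W F x₁).mp hx₁F₁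
      have hx₁0 : x₁ ≠ 0 := fun h0 => by
        rw [h0] at hx₁T
        exact hx₁T isAlgebraic_zero
      have hx₀u : IsUnit x₀ := by
        by_contra hnu
        exact hx₁0 (hx₀x₁ ▸ (residue_eq_zero_iff x₀).mpr ((IsLocalRing.mem_maximalIdeal _).mpr hnu))
      have hx₀1 : W.valuation (x₀ : Ω) = 1 := (W.valuation_eq_one_iff x₀).mp hx₀u
      have hx₀0 : (x₀ : Ω) ≠ 0 := fun h0 => by
        rw [h0, map_zero] at hx₀1
        exact zero_ne_one hx₀1
      have hntF : ∃ a ∈ F, a ≠ 0 ∧ W.valuation a ≠ 1 := by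
        obtain ⟨c', hc'K, hc'0, hc'1⟩ := hntW
        exact ⟨c', hKF hc'K, hc'0, hc'1⟩
      obtain ⟨y, hyF, hysep, hyval, hyres⟩ :=
        h54 Ω W K F hKF hfg hsep ⟨t, htF, ht, halg⟩ hntF x₀ hx₀F hx₀0
      have hyW : y ∈ W := (W.valuation_le_one_iff y).mp (by rw [hyval, hx₀1])
      have hyx₁ : residue W ⟨y, hyW⟩ = x₁ := by
        rw [← hx₀x₁]
        exact (residue_eq_residue_iff W ⟨y, hyW⟩ x₀).mpr (hyres hx₀1)
      have hyRT : IsResidueTranscendental W K y := ⟨hyW, by rw [hyx₁]; exact hx₁T⟩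
      -- the final step
      have hF₁le' : resField W F ≤ henselization (residueValuationSubring V W hVW)
          (Subfield.closure ((resField W K : Set (ResidueField W)) ∪
            {residue W ⟨y, hyRT.mem⟩})) := by
        have : residue W ⟨y, hyRT.mem⟩ = x₁ := hyx₁
        rw [this]
        exact hF₁le
      exact ⟨y, hyF, hyRT.transcendental,
        le_henselization_of_resField_le hVW hGST hKF hfg himm hyF hyRT hysep hF₁le'⟩

/-- **Kuhlmann 2019, Thm. 1.3 for a separably closed ground field of arbitrary rank, from
Prop. 5.2 (rank one)** and the printed ingredients of Props. 5.6 / 5.7: [17, Cor. 3.8/3.16]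
(`Kuhlmann2016_Cor38`), Lemma 5.4 (`Kuhlmann2019_Lemma54`), and the two clauses of [16, Thm. 1]
for rational function fields over separably closed fields with a value- resp.
residue-transcendental generator (`Kuhlmann2010SeparablyDefectlessRational_sepClosed`,
`Kuhlmann2010SeparablyDefectlessRationalRT_sepClosed`); [4, (18.2)] is discharged
(`Kuhlmann2010SeparablyDefectlessIffHenselization_holds`). [cite: Kuhlmann2019, Thm. 1.3] -/
theorem Kuhlmann2019_Thm13_sepClosed.of_prop52 (h38 : Kuhlmann2016_Cor38.{u})
    (h52 : Kuhlmann2019_Prop52_sepClosed.{u}) (h54 : Kuhlmann2019_Lemma54.{u})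
    (hVT : Kuhlmann2010SeparablyDefectlessRational_sepClosed.{u})
    (hRT : Kuhlmann2010SeparablyDefectlessRationalRT_sepClosed.{u}) :
    Kuhlmann2019_Thm13_sepClosed.{u} :=
  Kuhlmann2019_Thm13_sepClosed.of_prop56 h38 (Kuhlmann2019_Prop56_sepClosed.of_prop52 h52 hRT h54)
    h54 hVT Kuhlmann2010SeparablyDefectlessIffHenselization_holds

end Assembly

end Literature.AlgebraicGeometry.Resolution
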